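import Summits.BirchSwinnertonDyer.BirchSwinnertonDyer.Theorems.GenusKolyvaginAtTwoGenusDeepSupplyAtTwoNegDiscNarrowDepthZeroInstance
import HarnessLib

/-!
# Route `GenusKolyvaginAtTwo`, crux 23491 `GenusDeepSupplyAtTwoNegDiscNarrow` (and 25504), registered stub C‴:
# the depth-zero reduction criterion in `M₀`-FREE form — `y_K ∉ 2E(K[1])` from one reduction

Seat `bsd-line-gk2-p5` g33 (cell `bsd-f1-sign2`, WIDTH-5 attach), `--supports stmt-BirchSwinnertonDyer-23491 --as helper`.
THEOREMS ONLY (no definition, no named fact, no `sorry`).  **BSD is NOT proved by this file and no item is closed by it.**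

LEAD gk2-p1 g21's ask (bus 04:59Z): state the assembled criterion of `…DepthZeroInstance` (`DepthZero.depth_eq_zero_of_geomReduction_ne`:
«`red_ℓ(e_* P₀) ∉ red_ℓ(e_*(E(K)_tors^{Aut(K/ℚ)}))` at a good ramified `ℓ ∣ d_K` ⟹ `M₀ = 0`») ALSO in the currencies that plug in with no adapter:
* `not_exists_two_smul_derivedPoint_of_geomReduction_ne` — **`¬ ∃ Q ∈ E(K[1]), 2 • Q = P(1)`** (the `h`-shape of the LEAD's `K1_of_not_two_dvd`);
* `not_exists_two_pow_one_smul_derivedPoint_of_geomReduction_ne` — **`¬ ∃ Q ∈ E(K[1]), ((2 ^ (0 + 1) : ℕ) : ℤ) • Q = P(1)`** (the `hndiv`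
  binder of the LEAD's `exists_deepWitness_of_depth_zero`, verbatim);
* `not_exists_two_smul_of_geomReduction_ne` — the same in `E(K)`: **`¬ ∃ Q₀ ∈ E(K), 2 • Q₀ = P₀`**.
Sign-free.  References: [GrossLMS1991] §5 Prop. 5.3, §4 (4.1), Lemma 4.3; [McCallumLMS1991] §5 Lemma 5.1.
-/

set_option autoImplicit false
set_option linter.dupNamespace false -- `Summit.<P>.<Sub>` repeats `BirchSwinnertonDyer` (D-0017)

noncomputable section

open scoped Classical NumberField Pointwise

namespace Summit.BirchSwinnertonDyer.BirchSwinnertonDyer.Theorems.GenusSupplyNarrow.DepthZero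

open IsDedekindDomain Field NumberField WeierstrassCurve Literature.NumberTheory.EllipticCurves
  Literature.NumberTheory.EllipticCurves.ModularForms Literature.NumberTheory.GaloisRepresentations Rat.HeightOneSpectrum

variable {K : Type} [Field K] [NumberField K]

/-- **`y_K ∉ 2E(K[1])` FROM ONE REDUCTION** (`M₀`-free form of `depth_eq_zero_of_geomReduction_ne`): `r_an(E) = 0`, `ρ̄_{E,2}` onto,
`d_K·Δ_E ∉ ℚ²`, `K` Heegner, `d₁` a conductor-`1` Kolyvagin–Heegner datum with `P₀ ↦ P(1)`, `ℓ ∣ d_K` good; if `red_ℓ(e_* P₀)` is not the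
reduction of an `Aut(K/ℚ)`-fixed torsion point of `E(K)`, then `P(1) = y_K` has no square root in `E(K[1])` — the `h`-binder shape of
`GenusSupplyNarrow.K1_of_not_two_dvd`.  [cite: GrossLMS1991, §5 Prop. 5.3, §4 (4.1), Lemma 4.3] [cite: McCallumLMS1991, §5 Lemma 5.1] -/
theorem not_exists_two_smul_derivedPoint_of_geomReduction_ne (W : WeierstrassCurve ℚ) [W.IsElliptic] [W.IsGloballyMinimal]
    [NeZero (W.conductorNorm ℤ)] (hK : IsImaginaryQuadratic K) (hH : SatisfiesHeegnerHypothesis (W.conductorNorm ℤ) K)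
    (hr0 : W.analyticRank = 0) (hρ : W.HasSurjectiveModNGaloisRep 2) (hsq : ¬ IsSquare ((NumberField.discr K : ℚ) * W.Δ))
    {ℓ : ℕ} [Fact ℓ.Prime] (hℓ : (ℓ : ℤ) ∣ NumberField.discr K) (hΔ : ¬ (ℓ : ℤ) ∣ minimalDiscriminantInt W)
    (Dt : ModularParametrizationData W (W.conductorNorm ℤ)) (β : ℤ) (ι : K →+* ℂ) (d₁ : KolyvaginHeegnerData Dt β ι 1)
    {P₀ : (W.baseChange K).toAffine.Point}
    (hP₀ : Affine.Point.map (W' := W) (algebraMap K (ringClassField K ι 1)).toRatAlgHom P₀ = d₁.derivedPoint)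
    (hred : ∀ s : (W.baseChange K).toAffine.Point, IsOfFinAddOrder s → (∀ σ : K ≃ₐ[ℚ] K, σ • s = s) →
      geomReduction hΔ (Affine.Point.map (W' := W) (absEmbedding ℚ K) P₀ : W.geomPoints) ≠
        geomReduction hΔ (Affine.Point.map (W' := W) (absEmbedding ℚ K) s : W.geomPoints)) :
    ¬ ∃ Q : (W.baseChange (ringClassField K ι 1)).toAffine.Point, (2 : ℤ) • Q = d₁.derivedPoint := by
  rintro ⟨Q, hQ⟩
  have h := depth_eq_zero_of_geomReduction_ne W hK hH hr0 hρ hsq hℓ hΔ Dt β ι d₁ hP₀ hred (M₀ := 1) ⟨Q, by simpa using hQ⟩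
  exact one_ne_zero h

/-- **The same, VERBATIM the `hndiv` binder of `GenusSupplyNarrow.exists_deepWitness_of_depth_zero`** (`((2 ^ (0 + 1) : ℕ) : ℤ) • Q`), so that the
cruxes' deep clause with `n = 1` follows with no adapter.  [cite: GrossLMS1991, §4 (4.1)] [cite: McCallumLMS1991, §5 Lemma 5.1] -/
theorem not_exists_two_pow_one_smul_derivedPoint_of_geomReduction_ne (W : WeierstrassCurve ℚ) [W.IsElliptic] [W.IsGloballyMinimal]
    [NeZero (W.conductorNorm ℤ)] (hK : IsImaginaryQuadratic K) (hH : SatisfiesHeegnerHypothesis (W.conductorNorm ℤ) K)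
    (hr0 : W.analyticRank = 0) (hρ : W.HasSurjectiveModNGaloisRep 2) (hsq : ¬ IsSquare ((NumberField.discr K : ℚ) * W.Δ))
    {ℓ : ℕ} [Fact ℓ.Prime] (hℓ : (ℓ : ℤ) ∣ NumberField.discr K) (hΔ : ¬ (ℓ : ℤ) ∣ minimalDiscriminantInt W)
    (Dt : ModularParametrizationData W (W.conductorNorm ℤ)) (β : ℤ) (ι : K →+* ℂ) (d₁ : KolyvaginHeegnerData Dt β ι 1)
    {P₀ : (W.baseChange K).toAffine.Point}
    (hP₀ : Affine.Point.map (W' := W) (algebraMap K (ringClassField K ι 1)).toRatAlgHom P₀ = d₁.derivedPoint)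
    (hred : ∀ s : (W.baseChange K).toAffine.Point, IsOfFinAddOrder s → (∀ σ : K ≃ₐ[ℚ] K, σ • s = s) →
      geomReduction hΔ (Affine.Point.map (W' := W) (absEmbedding ℚ K) P₀ : W.geomPoints) ≠
        geomReduction hΔ (Affine.Point.map (W' := W) (absEmbedding ℚ K) s : W.geomPoints)) :
    ¬ ∃ Q : (W.baseChange (ringClassField K ι 1)).toAffine.Point, ((2 ^ (0 + 1) : ℕ) : ℤ) • Q = d₁.derivedPoint := by
  rintro ⟨Q, hQ⟩
  exact not_exists_two_smul_derivedPoint_of_geomReduction_ne W hK hH hr0 hρ hsq hℓ hΔ Dt β ι d₁ hP₀ hred ⟨Q, by simpa using hQ⟩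

/-- **`E(K)`-currency: `y_K ∉ 2E(K)`** under the same hypotheses (through `E(K) ↪ E(K[1])`; equivalently McCallum's Lemma 5.1 at `M = 1`).
[cite: McCallumLMS1991, §5 Lemma 5.1] [cite: GrossLMS1991, §5 Prop. 5.3] -/
theorem not_exists_two_smul_of_geomReduction_ne (W : WeierstrassCurve ℚ) [W.IsElliptic] [W.IsGloballyMinimal]
    [NeZero (W.conductorNorm ℤ)] (hK : IsImaginaryQuadratic K) (hH : SatisfiesHeegnerHypothesis (W.conductorNorm ℤ) K)
    (hr0 : W.analyticRank = 0) (hρ : W.HasSurjectiveModNGaloisRep 2) (hsq : ¬ IsSquare ((NumberField.discr K : ℚ) * W.Δ))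
    {ℓ : ℕ} [Fact ℓ.Prime] (hℓ : (ℓ : ℤ) ∣ NumberField.discr K) (hΔ : ¬ (ℓ : ℤ) ∣ minimalDiscriminantInt W)
    (Dt : ModularParametrizationData W (W.conductorNorm ℤ)) (β : ℤ) (ι : K →+* ℂ) (d₁ : KolyvaginHeegnerData Dt β ι 1)
    {P₀ : (W.baseChange K).toAffine.Point}
    (hP₀ : Affine.Point.map (W' := W) (algebraMap K (ringClassField K ι 1)).toRatAlgHom P₀ = d₁.derivedPoint)
    (hred : ∀ s : (W.baseChange K).toAffine.Point, IsOfFinAddOrder s → (∀ σ : K ≃ₐ[ℚ] K, σ • s = s) →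
      geomReduction hΔ (Affine.Point.map (W' := W) (absEmbedding ℚ K) P₀ : W.geomPoints) ≠
        geomReduction hΔ (Affine.Point.map (W' := W) (absEmbedding ℚ K) s : W.geomPoints)) :
    ¬ ∃ Q₀ : (W.baseChange K).toAffine.Point, (2 : ℤ) • Q₀ = P₀ := by
  rintro ⟨Q₀, hQ₀⟩
  refine not_exists_two_smul_derivedPoint_of_geomReduction_ne W hK hH hr0 hρ hsq hℓ hΔ Dt β ι d₁ hP₀ hred
    ⟨Affine.Point.map (W' := W) (algebraMap K (ringClassField K ι 1)).toRatAlgHom Q₀, ?_⟩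
  rw [← map_zsmul, hQ₀, hP₀]

end Summit.BirchSwinnertonDyer.BirchSwinnertonDyer.Theorems.GenusSupplyNarrow.DepthZero

end
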